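import Mathlib
import HarnessLib
import HarnessLib.Audit
import Summits.CriticalPhenomena.Statement
import Literature.Probability.Percolation.CriticalContinuityProofs
import Summits.CriticalPhenomena.PercolationContinuityZ3.Theorems.PercLowPointHalfSpaceQuantitativeBGNWallChain

/-!
Route: PercPorousCritical

# Route PercPorousCritical — porous critical cluster — quantitative BGN + gate counting against
Kesten–Zhang at the same p

It suffices to show X = K ∧ Q, two statements already wanted elsewhere, now glued by a NEW assembly.
K (FiniteClusterVolumeTail,
= crux K of route PercDebrisSweep): for every p with θ(p) > 0, P_p(m ≤ |C(0)| < ∞) ≤ exp(−c m^{2/3})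
for all m ≥ 1 — the Kesten–Zhang
surface-order law AT THE SAME p (a theorem for p > p_c; new only at a hypothetical percolating p_c).
Q (QuantitativeBGN, = crux C
of route PercLowPointHalfSpace): at p_c(ℤ³) the half-space one-arm probability from a floor point
decays like r^{−a} for SOME a > 0
(a rate in Barsky–Grimmett–Newman's θ_ℍ(p_c) = 0). Card realised: porous-core-deletion-critical —
its architecture (the critical
cluster is POROUS ⇒ finite-energy gate counting ⇒ finite-cluster tails at p_c fatter than surface
order ⇒ contradiction with a
same-p tail bound) is kept; its porosity engine (T) 'p_c(I) = 1 + isoperimetric p_c < 1 theory' is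
FALSE (thick-linked necklace /
the sponge S1 of card fkg-kills-fragility, see Why this line) and is REPLACED by a quantitative form
of Cerf–Dembin 2020
(anchored isoperimetry of the critical cluster vanishes, proved through BGN), whose only non-theorem
input is Q.
Lean: `(∀ p : unitInterval, 0 < Literature.Probability.Percolation.theta
(Literature.Probability.LatticeModels.zdGraph 3) 0 p → ∃ c : ℝ, 0 < c ∧ ∀ m : ℕ, 1 ≤ m →
(Literature.Probability.Percolation.bondPercolation (Literature.Probability.LatticeModels.zdGraph 3)
p).real {ω | (m : ℕ∞) ≤ (Literature.Probability.Percolation.openCluster ω 0).encard ∧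
(Literature.Probability.Percolation.openCluster ω 0).Finite} ≤ Real.exp (-(c * (m : ℝ) ^ ((2 : ℝ) /
3)))) ∧ (∃ a C : ℝ, 0 < a ∧ ∀ r : ℕ, 1 ≤ r → (Literature.Probability.Percolation.bondPercolation
(Literature.Probability.LatticeModels.zdGraph 3) (Literature.Probability.Percolation.criticalProbI
3)).real {ω | ∃ y : Literature.Probability.LatticeModels.Site 3, (∃ i : Fin 3, (r : ℤ) ≤ |y i|) ∧ ω
∈ Literature.Probability.Percolation.openConnIn {x : Literature.Probability.LatticeModels.Site 3 | 0
≤ x 0} 0 y} ≤ C * (r : ℝ) ^ (-a))`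

## Assembly
PROVED as the route's deciding theorem `closes : GateCounting → PorosityFromQBGN → QuantitativeBGN →
FiniteClusterVolumeTail → PercolationContinuityZ3` (planner glue rev 2, sorry-free, axioms
propext/Classical.choice/Quot.sound;
the `Assembly` item stmt-CriticalPhenomena-4821 stays listed (the gate does not drop assembly items)
but is now a one-liner from `closes`;
the route's real debt is exactly K, Q and the two supports).
Pure real analysis given the four antecedents: suppose θ* := theta (zdGraph 3) 0
(criticalProbI 3) ≠ 0, so θ* > 0 (measureReal_nonneg). PorosityFromQBGN θ* Q gives δ ∈ (0, 2/3), K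
and arbitrarily large s with
s^{−K} ≤ P_{p_c}(Cert_δ(s)). GateCounting at p = criticalProbI 3 (0 < p_c < 1: criticalProb_zd_pos,
criticalProb_zd_lt_one, in
tree) and K at p = p_c (θ* > 0) give P_{p_c}(Cert_δ(s)) ≤ ((12s+1)M)^{(2s)^δ} exp(−c s^{2/3}), M =
max(1, p_c/(1−p_c)). Taking
logarithms, −K log s ≤ (2s)^δ log((12s+1)M) − c s^{2/3}, false for all large s because δ < 2/3 —
contradiction with 'arbitrarily
large s'. Hence θ* = 0, i.e. PercolationContinuityZ3 (percolationContinuityZ3_iff).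
Lean route of the proof: 0 < p_c < 1 from criticalProb_zd_pos / criticalProb_zd_lt_one (route import
Literature.Probability.Percolation.CriticalContinuityProofs); with e := (2/3 − δ)/2 > 0: log x ≤
x^e/e (Real.log_le_rpow_div),
(2x)^δ ≤ 2x^δ, log((12x+1)M) ≤ log(13M) + log x, x^{2/3} = x^{δ+e}·x^e (Real.rpow_add), so the log
of the entropy factor is
≤ (2 log(13M) + 2/e)·x^{δ+e} and K log x ≤ (|K|/e)·x^{δ+e}; c·s^e → ∞ (tendsto_rpow_atTop along
tendsto_natCast_atTop_atTop)
eventually beats 2 log(13M) + (2+|K|)/e, and Frequently.and_eventually picks a scale s where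
PorosityFromQBGN's lower bound
s^{−K} meets GateCounting·FiniteClusterVolumeTail's upper bound — lt_irrefl.

Rationale: WHY THIS LINE. Suppose θ(p_c) = θ* > 0 and let I be the critical infinite cluster. CerfDembin2020
(arXiv:1903.08065, Thm 1.2, read in full) prove
that the anchored isoperimetric profile of C(0) at p_c vanishes a.s.: their exploration C_{l+1} =
C_l ∪ {endpoints of open boundary
edges} grows by |∂^o C_l|/6 per step inside [−l,l]³, so a d-dimensional anchored isoperimetric
inequality would push ≍ n² explored
vertices onto the faces of [−n,n]³, contradicting BGN (no percolation in half-spaces at p_c; in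
tree:
Literature.Probability.Percolation.BarskyGrimmettNewman1991_Z3_holds). Feeding the RATE Q into the
same two-phase argument (our
computation, NOTES.md: growth V_{l+1} ≥ V_l + c V_l^{(2−κ)/3} ⇒ V_l ≥ c l^{3/(1+κ)}; face count ≥ c
n^{3/(1+κ)−1−κ} against
E ≤ 6(2n+1)² C n^{−a}; Markov) gives, for every κ with 3κ/(1+κ) + κ < a, porosity CERTIFICATES: with
probability ≥ n^{−2} for
infinitely many n there is an open-connected H ∋ 0, c n^{3/(1+κ)} ≤ |H| ≤ n³, with at most |H|
n^{−1−κ} ≤ |H|^{(2−κ)/3} OPEN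
boundary edges (gates). Closing the gates (finite energy; entropy ≤ (12|H|+1)^{#gates},
AizenmanKestenNewmanCMP1987-style
bookkeeping, tools in Literature FiniteEnergy.lean) makes H a finite cluster: P_{p_c}(s ≤ |C(0)| <
∞) ≥ exp(−O(s^{(2−κ)/3} log s))
along a scale sequence — strictly fatter than the surface-order law exp(−c s^{2/3}) that K asserts
at the percolating p_c.
Contradiction, for ANY a > 0. Imported areas: anchored isoperimetry / Cheeger profile of percolation
clusters (Dembin2020,
CerfDembin2020, Pete2008, arXiv:2207.05226), max-flow intuition (Zhang2000: the critical flow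
constant vanishes), finite-energy
surgery. What prior routes do not do: PercDebrisSweep reaches fat tails exp(−m^{1−1/γ₀}) from a
SUBCRITICAL exponent bound γ₀ < 3
(no upper bound on γ is known in d = 3); here the fat tails come from the percolating phase itself
plus Q, so S is not needed, and
PercLowPointHalfSpace's cruxes A (a₂ > 5/2) and B (m ≤ 11/4) are not needed either: target ⇐ K ∧ Q.
Versus card
quarantine-fat-islands (K ∧ half-space arm exponent a > 4/5 via Rossignol–Théret quarantine walls):
the exploration amplifies the
isoperimetric deficit, so any a > 0 suffices. Why the card's own engine is dropped: Teixeira 2016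
(arXiv:1409.5923) needs LOCAL
isoperimetry (Def 1.3, boundary inside the ball), whose failure gives bottlenecks, not gate
certificates, and his Rem 5.1(d) already
records the idea and calls it very difficult; worse, a positive-density G ⊂ ℤ³ made of cubes of side
L_k chained space-fillingly
through L_k² parallel paths of length log² L_k (hierarchy L_{k+1} = L_k^γ) has p_c(G) = 1 while
(1+δ)-dimensional defects with
δ < 2/(3γ) occur only on the super-polynomially sparse link paths — so 'defect intensity ≤ s^{−K} ⇒
p_c < 1' ((T) of the card)
is false for every meaningful δ (same sponge as S1 of cards fkg-kills-fragility /
sponge-fkg-fragile-giant).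

RANKED CRUXES. #2 FiniteClusterVolumeTail (crux) — (K, shared with PercDebrisSweep
stmt-CriticalPhenomena-0943) Kesten–Zhang at the same p: for every p with θ(p) > 0 there is c > 0
with P_p(m ≤ |C(0)| < ∞) ≤ exp(−c m^{2/3}) for all m ≥ 1. A theorem for p > p_c (KZ90 = Grimmett1999
Thm (8.65), via Grimmett–Marstrand); new content only at a hypothetical percolating p_c.
Calibration: false for Aizenman–Newman 1/r² chains at their jump (power-law finite-cluster tails,
Imbrie–Newman), true in the ordered phase of random-cluster q > Q. [difficulty: XL] (why it might
fail: Printed proofs (KZ90, Cerf 2000) build Grimmett–Marstrand blocks at p' < p — the sprinkling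
barrier head-on; Zhang2000: the critical flow constant vanishes, and this route itself shows Q ⇒
¬K(p_c) in a jump world, so K must carry all the non-tameness of p_c.) [doi:10.1214/aop/1176990844,
Grimmett1999, GrimmettMarstrand1990, Zhang2000, arXiv:1707.08766, CerfDembin2020]
#3 QuantitativeBGN (crux) — (Q, shared with PercLowPointHalfSpace stmt-CriticalPhenomena-0913) at
p_c(ℤ³) the boundary one-arm probability P(C_ℍ(0) reaches sup-distance ≥ r), ℍ = {x₀ ≥ 0}, is ≤ C
r^{−a} for SOME a > 0 (numerically a = x_s ≈ 0.975). BGN's θ_ℍ(p_c) = 0 is proved in tree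
(BarskyGrimmettNewman1991_Z3_holds) but soft. Any a > 0 suffices for this route. [difficulty: L]
(why it might fail: BGN (Grimmett1999 Thm 7.35) is qualitative — {θ_ℍ > 0} is open via a finite-size
criterion — and no rate is in print for d = 3 (KozmaNitzan2024 p.2; ChatterjeeHanson needs d ≥ 11);
a power law wants a scale-uniform half-space crossing bound < 1 at p_c, an RSW-type input unknown in
3D.) [BarskyGrimmettNewman1991, Grimmett1999, KozmaNitzan2024, arXiv:1810.03750, CerfDembin2020]
#9 PorosityFromQBGN (support) — (quantitative Cerf–Dembin; the glue that replaces the card's (T)) if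
θ(p_c) > 0 and Q holds, then there are δ ∈ (0, 2/3) and K such that for infinitely many s, with
P_{p_c}-probability ≥ s^{−K} there is a finite S ∋ 0 with s ≤ |S| ≤ 2s, every vertex of S joined to
0 by an open path inside S, and at most |S|^δ open edges in the edge boundary of S. Proof
(NOTES.md): Borel–Cantelli on the failure events; phase 1 adaptive-scale exploration, V_{l+1} ≥ V_l
+ c V_l^{(2−κ)/3}; phase 2 in-box cluster of [−n,n]³, face count vs 6(2n+1)² C n^{−a} by isometry
invariance + Q + Markov; κ with 3κ/(1+κ) + κ < a, δ = (2−κ)/3, dyadic pigeonhole K = 1.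
Mathematically complete; formalisation ≈ exploration process + BC + lattice symmetries (L).
[difficulty: L] [CerfDembin2020, BarskyGrimmettNewman1991, Dembin2020]
#9 GateCounting (support) — (P, finite energy with entropy bookkeeping; provable now) for 0 < p < 1,
δ ≥ 0, s ≥ 1: P_p(certificate event of PorosityFromQBGN at (δ, s)) ≤ ((12s+1) · max(1,
p/(1−p)))^{(2s)^δ} · P_p(s ≤ |C(0)| < ∞). Proof: for a witness S with gate set F = open edges of ∂S
(|F| ≤ |S|^δ ≤ (2s)^δ, |∂S| ≤ 6|S| ≤ 12s): the event {S internally open-connected to 0, ∂S ∩ ω = F}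
has probability (p/(1−p))^{|F|} × P(S internally open-connected, ∂S closed) ≤
max(1,p/(1−p))^{(2s)^δ} P(C(0) = S) (independence of edges inside S, FiniteEnergy.lean /
determinedBy_openConnIn); at most (12s+1)^{(2s)^δ} sets F per S; the events {C(0) = S} are disjoint
and lie in {s ≤ |C(0)| ≤ 2s, finite}. [difficulty: provable-now] [AizenmanKestenNewmanCMP1987,
Grimmett1999]

TWO-LAYER PLAN. Foreseen glued splits (none filed now): PorosityFromQBGN ⇐ ExplorationGrowth (phase
1: a.s.-eventual anchored isoperimetry at
exponent 1+κ forces |C_l| ≥ c l^{3/(1+κ)}) → FaceCountVsHalfSpaceArm (phase 2: E #{face vertices of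
[−n,n]³ joined to 0 inside}
≤ 6(2n+1)² · P(arm_ℍ(0,n)) by isometry invariance of bondPercolation) → PorosityFromQBGN.
FiniteClusterVolumeTail ⇐ (same-p
coarse graining: θ(p) > 0 ⇒ linear-scale box long-range order, = X_D of PercFiniteBoxLRO) →
(Kesten–Zhang counting from block
LRO at the same p) → FiniteClusterVolumeTail. QuantitativeBGN ⇐ (scale-uniform half-space
shell-crossing bound < 1 at p_c) →
(multi-scale independence ⇒ power law) → QuantitativeBGN — owned by PercLowPointHalfSpace; we only
attach.

KILL CRITERIA. A refutation of FiniteClusterVolumeTail (e.g. a soft argument that at ANY percolating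
p finite-cluster volume tails can beat
exp(−c m^{2/3}), or a Potemkin jump world consistent with all proved facts and ¬K) closes this route
AND breaks PercDebrisSweep —
close `refuted:FiniteClusterVolumeTail`; no pivot to a weaker η is possible here (the porosity
exponent is only (2−κ)/3, κ small).
A refutation of QuantitativeBGN (half-space arm decaying slower than every power at p_c) closes the
route (and item C of
PercLowPointHalfSpace); pivot target: the qualitative Cerf–Dembin porosity only gives o(1)·s^{2/3}
gates, which loses to the
entropy factor log s — dead without a rate. If PorosityFromQBGN's proof is found wrong (check
NOTES.md derivation: the adaptive
scale in phase 1, the size window c n^{3/(1+κ)} ≤ |H| ≤ n³, the corner count 3 per face vertex) the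
route is void — cheapest
check below. θ(p_c) = 0 proved elsewhere moots it; K proved ⇒ DebrisSweep still needs S, we need
only Q.

NOT DECOMPOSED YET. The two phases of PorosityFromQBGN (exploration growth lemma; face count by
isometry invariance + Markov) and its Borel–Cantelli
bookkeeping; the measurability of the certificate events; the isometry invariance of bondPercolation
(zdGraph 3) under reflections
and translations (needed to move a face vertex to the origin); the discrete ODE lemma a_{l+1} ≥ a_l
+ c a_l^α ⇒ a_l ≳ l^{1/(1−α)};
constants κ(a), δ = (2−κ)/3. All are layer-2 children of the support items, filed only if a prover
asks. No decomposition of K or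
Q here (they are owned by PercDebrisSweep / PercLowPointHalfSpace; this route attaches via
wanted_by).

CHEAPEST FALSIFIER. Re-derive the exponent inequality of PorosityFromQBGN on paper (15 minutes):
with e₁ = 3/(1+κ) − 1 − κ the contradiction needs
e₁ > 2 − a, i.e. a > 3κ/(1+κ) + κ, solvable for every a > 0 — if a refuter finds the phase-1 growth
bound needs the isoperimetric
hypothesis at sizes BELOW c n^{3/(1+κ)} (where the certificate would be too small to matter) or that
in-box open boundary edges
need not exit the box, the glue dies. Second cheapest: check K against Zhang2000/Rossignol–Théret
(arXiv:1707.08766 Prop 3.9): does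
the vanishing critical flow constant plus linear-scale local uniqueness already give P_{p_c}(m ≤ |C|
< ∞) ≥ exp(−o(m^{2/3})) at a
percolating p_c WITHOUT Q? If yes, K alone would be contradictory in the jump world only together
with a local-uniqueness input —
compare with card quarantine-fat-islands' (QI); that would not kill the route but would show Q can
be weakened further.

NUMBERS. p_c^bond(ℤ³) ≈ 0.2488; surface-order exponent (d−1)/d = 2/3 (Kesten–Zhang, p > p_c);
half-space one-arm exponent a ≈ x_s ≈ 0.975
(numerics quoted in PercLowPointHalfSpace); porosity exponent delivered δ = (2−κ)/3 with κ < κ(a),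
κ(0.975) ≈ 0.30 (δ ≈ 0.57),
κ → 0 as a → 0; certificate probability ≥ s^{−1} along a scale sequence; entropy factor
(12s+1)^{(2s)^δ}. Items at open: 5
(2 cruxes, 2 supports, 1 assembly).

DEFINITION REQUESTS. None: all statements are over bondPercolation, theta, criticalProbI,
openCluster, openConnIn, zdGraph, Site, edgeBoundary
(Literature.Probability.{Percolation,LatticeModels}). A cite fact for Kesten–Zhang 1990
(Grimmett1999 Thm (8.65), p > p_c) would
be useful Literature context for K but is not load-bearing.

Novelty: Searches (2026-08-15): `lit search --source zbmath "isoperimetric percolation critical probability"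
--year-from 2015` (16 rows:
found CerfDembin2020 arXiv:1903.08065, Dembin2020 arXiv:1810.11239, Hutchcroft arXiv:2207.05226,
Teixeira arXiv:1409.5923,
Haslegrave–Panagiotis arXiv:1905.09723, Hutchcroft–Tointon arXiv:2104.05607); `lit search --source
zbmath "percolation half-space
critical" --year-from 2012` (15 rows, nothing quantitative on BGN in d = 3; ChatterjeeHanson
arXiv:1810.03750 is d ≥ 11);
`lit read arxiv:1409.5923` (Teixeira: Def 1.3, Thm 1.4, Rem 2.3, Rem 5.1(d)) and `lit read
arxiv:1903.08065` (Cerf–Dembin, whole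
paper); `lit frontier CriticalPhenomena --since 2019` (30 rows, none on isoperimetry of critical
clusters); `lit bridges
CriticalPhenomena --cross any`; local `lit search`/`--hybrid` tier DOWN (searchd connection reset
×3), OpenAlex/arXiv HTTP 429,
`lit galaxy search "anchored isoperimetric profile percolation critical cluster" --star all` queued
out (> 90 s) — recorded in
NOTES.md; in-hub: all 9 Theses of the sub and cards quarantine-fat-islands,
critical-cluster-threshold-one, fkg-kills-fragility,
sponge-fkg-fragile-giant, isoperimetry-plus-gamma-lt-3, maxflow-budget-ladder read.
Nearest prior art found: CerfDembin2020 (arXiv:1903.08065, Thm 1.2: liminf n φ̂_n(p_c) = 0 a.s. —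
qualitative porosity of the
critical cluster via exploration + BGN); Zhang2000 / arXiv:1707.08766 (critical flow constant
vanishes); doi:10.1214/aop/1176990844
(Kesten–Zhang surface  [refs: 10.1214/aop/1176990844, 1903.08065, 1810.11239, 2207.05226, 1409.5923, 1905.09723, 2104.05607, 1810.03750, 1707.08766, arxiv:1409.5923, arxiv:1903.08065, doi:10.1214/aop/1176990844, CerfDembin2020, Dembin2020, Zhang2000]

Barriers (technique_class: anchored-isoperimetry gate-counting half-space-arm same-p): - technique_class: anchored-isoperimetry gate-counting half-space-arm same-p
- Literature.Barriers.CriticalPhenomena.SprinklingRenormalisation: it does not evade it for K —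
every printed proof of the surface-order law runs Grimmett–Marstrand blocks at p' < p; the bet is
that 'density ⇒ surface tension' holds at η = 0 (the open half of a same-p finite-size criterion); Q
sits exactly in the barrier's catalogued evasion (half-space steering needs 'no extra money', BGN),
and the glue is entirely at p = p_c.
- Literature.Barriers.CriticalPhenomena.LongRangeDiscontinuity: evaded through K and Q, both
false/meaningless for the 1/r² chains on ℤ (Imbrie–Newman: power-law finite-cluster tails in their
percolating phase; no half-spaces of a line carry BGN) — finite range and d = 3 geometry enter
through the surface-order exponent 2/3 and the half-space.
- Literature.Barriers.CriticalPhenomena.RandomClusterFirstOrder: the contradiction is not q-uniform: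
for wired FK with q > Q at p_c(q) the ordered phase percolates in half-spaces, so the Q-analogue
fails there (BGN's steering proof uses independence), while the K-analogue holds — the argument
separates q = 1 from q > Q at Q, as it must.
- Literature.Barriers.CriticalPhenomena.TreesPercolatingAtCriticality: not triggered — nothing
graph-general is used (faces of boxes, half-spaces, |∂S| ≤ 6|S|, surface order 2/3 are ℤ³-specific);
the card's graph-general engine (isoperimetry ⇒ p_c < 1) is precisely the part dropped as false.
- Literature.

Novelty grade: new-combination — route-review grade (refuter rreview-44da71cc, papers read at page level: 2207.05226 pp.4,9; 1903.08065 pp.3,5,6). The K-side of the glue (GateCounting 4820 + Borel-Cantelli skeleton) is PUBLISHED: Hutchcroft 2023 Prop 3.1, explicitly for p_c <= p < 1, giving from K(p_c) a t^{2/3}/log t anchored isop (refuter refuter-rreview-route-CriticalPhenomena--44da71cc-0, 2026-08-15T14:05:03Z; prior: arXiv:2207.05226 (Hutchcroft 2023 EJP, Prop 3.1: gate counting + union bound at p_c <= p < 1 => psi-anchored isoperimetry, psi = t^{2/3}/log t), arXiv:1903.08065 (Cerf-Dembin 2020 ECP, Thm 1.2: liminf n phi_n(p_c) = 0 via in-box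 exploration + BGN), doi:10.1214/aop/1176990844 (Kesten-Zhang 1990: surface-order finite-cluster tails for p > p_c), BarskyGrimmettNewman1991 (theta_H(p_c) = 0, qualitative)

sub-problem: PercolationContinuityZ3 · status: open · opened planner-plancard-CriticalPhenomena-Percolatio-1af72b13-0 2026-08-15T11:35:11Z · rev 4 · ledger route-CriticalPhenomena-PercPorousCritical
GENERATED by the gate from the ledger (D-0016/17). Provers cite these decls: `theorem foo : Summit.CriticalPhenomena.PercolationContinuityZ3.Theses.PercPorousCritical.<Decl> := …` in Summits/CriticalPhenomena/PercolationContinuityZ3/Theorems/<Name>.lean.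
-/

namespace Summit.CriticalPhenomena.PercolationContinuityZ3.Theses.PercPorousCritical

open scoped BigOperators Topology Manifold Classical MeasureTheory ProbabilityTheory Matrix InnerProductSpace ComplexConjugate ContinuousMap
open Filter Set Function TopologicalSpace MeasureTheory

attribute [summit_statement] _root_.PercolationContinuityZ3

/-- item stmt-CriticalPhenomena-0943 · crux · rank 2 · closed · proved by Summit.CriticalPhenomena.PercolationContinuityZ3.Theorems.PercPorousCriticalFiniteClusterVolumeTail.finiteClusterVolumeTail_proof @ 175ae9e337de (prover) · by planner
why it might fail: Open only at a percolating p_c: for p>p_c it is Grimmett1999 Thm (8.65), in tree as Grimmett1999_thm_8_65_holds; every printed proof incl. arXiv:2603.03257 Thm 1 (2026) sprinkles from p'<p (its §2: no sprinkling under θ(p)>0 alone), and this route's closes gives θ(p_c)>0 ∧ Q ⇒ ¬K(p_c).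
sources: KestenZhang1990, Grimmett1999, GrimmettMarstrand1990, arXiv:2603.03257, Hutchcroft2023, Zhang2000
[crux] r3 (K): Kesten-Zhang surface-order law AT THE SAME p: for every p with theta(p) > 0 there is
c > 0 with P_p(m <= |C(0)| < oo) <= exp(-c m^{2/3}) for all m >= 1 (event written with (openCluster
ω 0).encard and .Finite). A THEOREM for p > p_c (KestenZhang1990 doi:10.1214/aop/1176990844 =
Grimmett1999 Thm (8.65) p.216; Cerf 2000 Wulff LDP), all via Grimmett-Marstrand; the only new
content is the hypothetical percolating p = p_c. Calibration: FALSE for Aizenman-Newman 1/r^2 chains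
at their jump (power-law finite-cluster tails), TRUE in the ordered phase of random-cluster q > Q at
p_c(q). Shared in spirit with quarantine-fat-islands (KzSameP) and porous-core-deletion-critical
(L_{2/3}); by Grimmett1999 Thm (8.61) at a percolating p_c (ADS, needs only theta > 0) the bound
would be tight-order. Sources: doi:10.1214/aop/1176990844; Grimmett1999 Thm (8.65),(8.61);
arXiv:1902.03207. -/
@[route_item "route-CriticalPhenomena-PercPorousCritical"]
def FiniteClusterVolumeTail : Prop :=
  ∀ p : unitInterval, 0 < Literature.Probability.Percolation.theta (Literature.Probability.LatticeModels.zdGraph 3) 0 p → ∃ c : ℝ, 0 < c ∧ ∀ m : ℕ, 1 ≤ m → (Literature.Probability.Percolation.bondPercolation (Literature.Probability.LatticeModels.zdGraph 3) p).real {ω | (m : ℕ∞) ≤ (Literature.Probability.Percolation.openCluster ω 0).encard ∧ (Literature.Probability.Percolation.openCluster ω 0).Finite} ≤ Real.exp (-(c * (m : ℝ) ^ ((2 : ℝ) / 3)))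

/-- item stmt-CriticalPhenomena-0913 · crux · rank 3 · SPLIT (gen 1) into FootprintTail, ThinFootTall + glue Summit.CriticalPhenomena.PercolationContinuityZ3.Theorems.quantitativeBGN_of_footprintTail_of_thinFootTall · direct attempts still welcome (low priority) · by planner
why it might fail: BGN (Grimmett1999 Thm 7.35 p.163) is qualitative: its finite-size criterion exists only under θ_ℍ(p)>0, so no rate extracts (KozmaNitzan2024 p.2); half-space rates exist only for d>6 (arXiv:1810.03750, 2512.13624); a power law needs a scale-uniform half-space crossing bound <1 at p_c, unknown in 3D
sources: BarskyGrimmettNewman1991, Grimmett1999, KozmaNitzan2024, ChatterjeeHanson2020, arXiv:2512.13624, DengBlote2005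
[crux] r4 (C): quantitative Barsky-Grimmett-Newman. At p_c(Z^3) the boundary one-arm probability
P(C_H(0) reaches sup-distance >= r) <= C r^{-a} for SOME a > 0 (numerically a = x_s ~ 0.975,
Deng-Blote 2005). BGN's theta_H(p_c) = 0 (proved in tree: BarskyGrimmettNewman1991_Z3_holds) is
soft, by contradiction through a finite-size criterion; a rate needs a renewal/multi-scale version
of steering. Publishable alone; wanted in spirit by cards counterfactual-cluster-resistance,
boundary-critical-squeeze, climb-ratio-receding-floor-v2, quarantine-fat-islands (which needs a >
4/5). Sources: Grimmett1999 Thm (7.35) pp.162-169; KozmaNitzan2024 p.2 item 4 (no rate for BGN in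
print); doi:10.1103/PhysRevE.71.016117. -/
@[route_item "route-CriticalPhenomena-PercPorousCritical"]
def QuantitativeBGN : Prop :=
  ∃ a C : ℝ, 0 < a ∧ ∀ r : ℕ, 1 ≤ r → (Literature.Probability.Percolation.bondPercolation (Literature.Probability.LatticeModels.zdGraph 3) (Literature.Probability.Percolation.criticalProbI 3)).real {ω | ∃ y : Literature.Probability.LatticeModels.Site 3, (∃ i : Fin 3, (r : ℤ) ≤ |y i|) ∧ ω ∈ Literature.Probability.Percolation.openConnIn {x : Literature.Probability.LatticeModels.Site 3 | 0 ≤ x 0} 0 y} ≤ C * (r : ℝ) ^ (-a)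

-- parent: QuantitativeBGN · child (gen 1)
/--     item stmt-CriticalPhenomena-18032 · crux · rank 301 · open
    parent: QuantitativeBGN · by operator
    why it might fail: Volume-type rate AT p_c (θ_F≈x_s/d_F≈0.95 numerically): the one engine in tree (wall two-ghost+bootstrap) needs K2_T, a weakly long-range-enhanced wall staying subcritical uniformly in p<p_c (special-point positivity, x_s>1/2; no tool); squaring at p_c dies on coalescence (error linear in the tail).
    sources: BarskyGrimmettNewman1991, Grimmett1999, Hutchcroft2020Locality, arXiv:1808.08940, DengBlote2005, Summits/CriticalPhenomena/PercolationContinuityZ3/Theorems/PercLowPointHalfSpaceQuantitativeBGNWallChain.lean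
[crux] FAT PART of QuantitativeBGN (exact Fat/Thin cut; crux-strategist s2 split on route
PercPorousCritical, 2026-08-17, prepared and certified by strategist s1 for PercLowPointHalfSpace):
the wall FOOTPRINT F = |C_H(0) ∩ {x₀ = 0}| of the critical half-space cluster has a polynomial tail,
P_{p_c(ℤ³)}(F ≥ n) ≤ B n^{-θ} for some θ > 0. Written over the crux's own vocabulary (the set {v | 0
↔ v in H} ∩ {v₀ = 0} and Set.encard); DEFINITIONALLY `footGe 0 n` of Theorems/…WallDefs.lean and `n
≤ halfSpaceFootprint ω` of Literature HalfSpacePinnedPairs (`footAt_zero`). NECESSARY for the crux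
(θ = a/2: a footprint of n wall vertices forces an arm to sup-distance ⌊√n⌋/2;
`footprintTail_of_quantitativeBGN`, …WallChain.lean) and, with the thin sibling ThinFootTall,
SUFFICIENT (glue = landed `quantitativeBGN_of_footprintTail_of_thinFootTall`, p132020/p132176;
re-typed for this route as the registered stub `quantitativeBGN_porous_of_subs`, candidate file
PercPorousCriticalQuantitativeBGNSplit.lean attached to stmt-0913, lean check rc 0, axioms
standard). A statement about the stationary ℤ²-process of wall footprints; tools in tree: wall
two-ghost inequality for any ℤ²-invariant bond class (…Wall -/
@[route_item "route-CriticalPhenomena-PercPorousCritical"]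
def FootprintTail : Prop :=
  ∃ θ B : ℝ, 0 < θ ∧ ∀ n : ℕ, 1 ≤ n → (Literature.Probability.Percolation.bondPercolation (Literature.Probability.LatticeModels.zdGraph 3) (Literature.Probability.Percolation.criticalProbI 3)).real {ω | (n : ℕ∞) ≤ ({v : Literature.Probability.LatticeModels.Site 3 | ω ∈ Literature.Probability.Percolation.openConnIn {x : Literature.Probability.LatticeModels.Site 3 | 0 ≤ x 0} 0 v} ∩ {v : Literature.Probability.LatticeModels.Site 3 | v 0 = 0}).encard} ≤ B * (n : ℝ) ^ (-θ)

-- parent: QuantitativeBGN · child (gen 1)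
/--     item stmt-CriticalPhenomena-18033 · crux · rank 302 · open
    parent: QuantitativeBGN · by operator
    why it might fail: Arm-type rate on the rare thin-foot corner (a(1/2)≈2.0 numerically; any a>0 needed): every p-blind handle (launch/level mass transport, FKG, sealing (1−p)^{-r^δ}, BK/Reimer excursion recursion: per-level factor p_c·E[F;F≤m]>1 from m≈20) returns the crux or a factor ≥1; BGN is qualitative.
    sources: BarskyGrimmettNewman1991, Grimmett1999, Hutchcroft2020Locality, DengBlote2005, Summits/CriticalPhenomena/PercolationContinuityZ3/Theorems/PercLowPointHalfSpaceQuantitativeBGNThinFootReshape.lean, Summits/CriticalPhenomena/PercolationContinuityZ3/Cruxes/QuantitativeBGN/Lines/longrange-wall-ghost-bootstrap-dead.md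
[crux] THIN PART of QuantitativeBGN (exact Fat/Thin cut; crux-strategist s2 split on route
PercPorousCritical, 2026-08-17): thin-footed FAR-REACHING critical half-space clusters are
polynomially rare — P_{p_c(ℤ³)}(arm_H(0,r) ∧ F ≤ ⌊r^δ⌋) ≤ C r^{-a} for some a, δ > 0, F = |C_H(0) ∩
{x₀=0}|; the arm event is the crux's own, the footprint over crux vocabulary (DEFINITIONALLY `armH r
∩ {footAt ω 0 ≤ ⌊r^δ⌋₊}` of …WallDefs/…WallChain). NECESSARY for the crux (the event is inside
arm_H(0,r); `thinFootTall_of_quantitativeBGN`) and, with FootprintTail, SUFFICIENT (glue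
`quantitativeBGN_of_footprintTail_of_thinFootTall`, landed; route form = registered stub
`quantitativeBGN_porous_of_subs`). Kernel-EQUIVALENT to the HEIGHT form ThinFootHigh 'P(∃ v ∈
C_H(0), v₀ ≥ k, F ≤ ⌊k^δ⌋) ≤ C k^{-a}' (`thinFootTall_iff_thinFootHigh`, …ThinFootReshape.lean,
p138124) = the registered stub `stub_thinFootHigh` of the skeleton longrange_wall_ghost_bootstrap. ∃
δ > 0 is the weakest form the glue accepts (smaller δ = smaller event); the threshold must grow
polynomially (a log-threshold would need exponential footprint tails, false). TRUE with exponential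
room at every p ≠ p_c (sharpness below; above, a thin-foo -/
@[route_item "route-CriticalPhenomena-PercPorousCritical"]
def ThinFootTall : Prop :=
  ∃ a δ C : ℝ, 0 < a ∧ 0 < δ ∧ ∀ r : ℕ, 1 ≤ r → (Literature.Probability.Percolation.bondPercolation (Literature.Probability.LatticeModels.zdGraph 3) (Literature.Probability.Percolation.criticalProbI 3)).real ({ω | ∃ y : Literature.Probability.LatticeModels.Site 3, (∃ i : Fin 3, (r : ℤ) ≤ |y i|) ∧ ω ∈ Literature.Probability.Percolation.openConnIn {x : Literature.Probability.LatticeModels.Site 3 | 0 ≤ x 0} 0 y} ∩ {ω | ({v : Literature.Probability.LatticeModels.Site 3 | ω ∈ Literature.Probability.Percolation.openConnIn {x : Literature.Probability.LatticeModels.Site 3 | 0 ≤ x 0} 0 v} ∩ {v : Literature.Probability.LatticeModels.Site 3 | v 0 = 0}).encard ≤ ((⌊(r : ℝ) ^ δ⌋₊ : ℕ) : ℕ∞)}) ≤ C * (r : ℝ) ^ (-a)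

/-- glue for the split of `QuantitativeBGN`: landed theorem `Summit.CriticalPhenomena.PercolationContinuityZ3.Theorems.quantitativeBGN_of_footprintTail_of_thinFootTall`. -/
theorem QuantitativeBGNGlueBy_holds : FootprintTail → ThinFootTall → QuantitativeBGN := _root_.Summit.CriticalPhenomena.PercolationContinuityZ3.Theorems.quantitativeBGN_of_footprintTail_of_thinFootTall

/-- item stmt-CriticalPhenomena-4819 · support · rank 9 · closed · proved by Summit.CriticalPhenomena.PercolationContinuityZ3.Theorems.PercPorousCriticalPorosityFromQBGN.porosityFromQBGN_proof @ 4f66980a76c6 (prover) · by planner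
sources: CerfDembin2020, BarskyGrimmettNewman1991, Dembin2020, Hutchcroft2023
[support] (quantitative Cerf–Dembin; the glue that replaces the card's (T)) if θ(p_c) > 0 and Q
holds, then there are δ ∈ (0, 2/3) and K such that for infinitely many s, with P_{p_c}-probability ≥
s^{−K} there is a finite S ∋ 0 with s ≤ |S| ≤ 2s, every vertex of S joined to 0 by an open path
inside S, and at most |S|^δ open edges in the edge boundary of S. Proof (NOTES.md): Borel–Cantelli
on the failure events; phase 1 adaptive-scale exploration, V_{l+1} ≥ V_l + c V_l^{(2−κ)/3}; phase 2
in-box cluster of [−n,n]³, face count vs 6(2n+1)² C n^{−a} by isometry invariance + Q + Markov; κ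
with 3κ/(1+κ) + κ < a, δ = (2−κ)/3, dyadic pigeonhole K = 1. Mathematically complete; formalisation
≈ exploration process + BC + lattice symmetries (L). [difficulty: L] -/
@[route_item "route-CriticalPhenomena-PercPorousCritical"]
def PorosityFromQBGN : Prop :=
  0 < Literature.Probability.Percolation.theta (Literature.Probability.LatticeModels.zdGraph 3) 0 (Literature.Probability.Percolation.criticalProbI 3) → (∃ a C : ℝ, 0 < a ∧ ∀ r : ℕ, 1 ≤ r → (Literature.Probability.Percolation.bondPercolation (Literature.Probability.LatticeModels.zdGraph 3) (Literature.Probability.Percolation.criticalProbI 3)).real {ω | ∃ y : Literature.Probability.LatticeModels.Site 3, (∃ i : Fin 3, (r : ℤ) ≤ |y i|) ∧ ω ∈ Literature.Probability.Percolation.openConnIn {x : Literature.Probability.LatticeModels.Site 3 | 0 ≤ x 0} 0 y} ≤ C * (r : ℝ) ^ (-a)) → ∃ δ K : ℝ, 0 < δ ∧ δ < 2 / 3 ∧ ∃ᶠ s : ℕ in Filter.atTop, (s : ℝ) ^ (-K) ≤ (Literature.Probability.Percolation.bondPercolation (Literature.Probability.LatticeModels.zdGraph 3) (Literature.Probability.Percolation.criticalProbI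 3)).real {ω | ∃ S : Finset (Literature.Probability.LatticeModels.Site 3), (s : ℝ) ≤ S.card ∧ (S.card : ℝ) ≤ 2 * s ∧ (∀ x ∈ S, ω ∈ Literature.Probability.Percolation.openConnIn (↑S : Set (Literature.Probability.LatticeModels.Site 3)) 0 x) ∧ (((Literature.Probability.LatticeModels.edgeBoundary (Literature.Probability.LatticeModels.zdGraph 3) S).filter (fun e => e ∈ ω)).card : ℝ) ≤ (S.card : ℝ) ^ δ}

/-- item stmt-CriticalPhenomena-4820 · support · rank 9 · closed · proved by Summit.CriticalPhenomena.PercolationContinuityZ3.Theorems.GateCounting.gateCounting_proof @ a1a8cc20c498 (prover) · by planner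
sources: Hutchcroft2023, AizenmanKestenNewmanCMP1987, Grimmett1999
[support] (P, finite energy with entropy bookkeeping; provable now) for 0 < p < 1, δ ≥ 0, s ≥ 1:
P_p(certificate event of PorosityFromQBGN at (δ, s)) ≤ ((12s+1) · max(1, p/(1−p)))^{(2s)^δ} · P_p(s
≤ |C(0)| < ∞). Proof: for a witness S with gate set F = open edges of ∂S (|F| ≤ |S|^δ ≤ (2s)^δ, |∂S|
≤ 6|S| ≤ 12s): the event {S internally open-connected to 0, ∂S ∩ ω = F} has probability
(p/(1−p))^{|F|} × P(S internally open-connected, ∂S closed) ≤ max(1,p/(1−p))^{(2s)^δ} P(C(0) = S)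
(independence of edges inside S, FiniteEnergy.lean / determinedBy_openConnIn); at most
(12s+1)^{(2s)^δ} sets F per S; the events {C(0) = S} are disjoint and lie in {s ≤ |C(0)| ≤ 2s,
finite}. [difficulty: provable-now] -/
@[route_item "route-CriticalPhenomena-PercPorousCritical"]
def GateCounting : Prop :=
  ∀ p : unitInterval, 0 < (p : ℝ) → (p : ℝ) < 1 → ∀ δ : ℝ, 0 ≤ δ → ∀ s : ℕ, 1 ≤ s → (Literature.Probability.Percolation.bondPercolation (Literature.Probability.LatticeModels.zdGraph 3) p).real {ω | ∃ S : Finset (Literature.Probability.LatticeModels.Site 3), (s : ℝ) ≤ S.card ∧ (S.card : ℝ) ≤ 2 * s ∧ (∀ x ∈ S, ω ∈ Literature.Probability.Percolation.openConnIn (↑S : Set (Literature.Probability.LatticeModels.Site 3)) 0 x) ∧ (((Literature.Probability.LatticeModels.edgeBoundary (Literature.Probability.LatticeModels.zdGraph 3) S).filter (fun e => e ∈ ω)).card : ℝ) ≤ (S.card : ℝ) ^ δ} ≤ ((12 * (s : ℝ) + 1) * max 1 ((p : ℝ) / (1 - (p : ℝ)))) ^ ((2 * (s : ℝ)) ^ δ)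 * (Literature.Probability.Percolation.bondPercolation (Literature.Probability.LatticeModels.zdGraph 3) p).real {ω | (s : ℕ∞) ≤ (Literature.Probability.Percolation.openCluster ω 0).encard ∧ (Literature.Probability.Percolation.openCluster ω 0).Finite}

/-- item stmt-CriticalPhenomena-4821 · assembly · rank 1 · closed · proved by Summit.CriticalPhenomena.PercolationContinuityZ3.Theorems.PercPorousCriticalAssembly.assembly_proof @ 175ae9e337de (prover) · by planner
sources: CerfDembin2020, doi:10.1214/aop/1176990844, Grimmett1999
[assembly] GateCounting → PorosityFromQBGN → QuantitativeBGN → FiniteClusterVolumeTail →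
PercolationContinuityZ3 (θ(p_c) = 0 on ℤ³). -/
@[route_item "route-CriticalPhenomena-PercPorousCritical"]
def Assembly : Prop :=
  GateCounting → PorosityFromQBGN → QuantitativeBGN → FiniteClusterVolumeTail → PercolationContinuityZ3

/-! D-0027 §2.1 — DECIDING THEOREM (planner-authored via `route open/edit --closes-file`; by planner-rbadge-CriticalPhenomena-PercPorousCri-6cf21507-g4-0 2026-08-15T16:54:56Z):
its hypotheses are this route's items and its conclusion the sub-problem Statement (glue_lint), and it elaborates with this file. -/

@[closes "route-CriticalPhenomena-PercPorousCritical"] theorem closes : GateCounting → PorosityFromQBGN → QuantitativeBGN → FiniteClusterVolumeTail → _root_.PercolationContinuityZ3 := by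
  intro hG hP hQ hK
  -- (1) the real-analysis kernel: for δ + 2e = 2/3, e > 0, the entropy factor loses to the surface-order term
  have key : ∀ (δ K c M e x : ℝ), 0 < δ → 0 < e → δ + e + e = 2 / 3 → 0 < c → 1 ≤ M → 1 ≤ x →
      2 * Real.log (13 * M) + 2 * e⁻¹ + |K| * e⁻¹ < c * x ^ e →
      ((12 * x + 1) * M) ^ ((2 * x) ^ δ) * Real.exp (-(c * x ^ ((2 : ℝ) / 3))) < x ^ (-K) := by
    intro δ K c M e x hδ0 he0 hsum hc hM1 hx1 hB
    have hx0 : 0 < x := by linarith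
    have hδ1 : δ ≤ 1 := by linarith
    have hM0 : 0 < M := by linarith
    have hb0 : 0 < (12 * x + 1) * M := by positivity
    have hb1 : 1 ≤ (12 * x + 1) * M := one_le_mul_of_one_le_of_one_le (by linarith) hM1
    have hb13 : (12 * x + 1) * M ≤ 13 * M * x := by
      have h := mul_le_mul_of_nonneg_right (show 12 * x + 1 ≤ 13 * x by linarith) hM0.le
      linarith [h]
    have hlb0 : 0 ≤ Real.log ((12 * x + 1) * M) := Real.log_nonneg hb1
    have hlb : Real.log ((12 * x + 1) * M) ≤ Real.log (13 * M) + Real.log x := by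
      have h := Real.log_le_log hb0 hb13
      rwa [Real.log_mul (by positivity) hx0.ne'] at h
    have hL0 : 0 ≤ Real.log (13 * M) := Real.log_nonneg (by linarith)
    have ht0 : 0 ≤ Real.log x := Real.log_nonneg hx1
    have ht : Real.log x ≤ e⁻¹ * x ^ e := by
      have h := Real.log_le_rpow_div hx0.le he0
      rwa [div_eq_inv_mul] at h
    have hie0 : 0 < e⁻¹ := inv_pos.mpr he0
    have hE0 : 0 ≤ (2 * x) ^ δ := Real.rpow_nonneg (by linarith) δ
    have hxδ0 : 0 ≤ x ^ δ := Real.rpow_nonneg hx0.le δ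
    have hE : (2 * x) ^ δ ≤ 2 * x ^ δ := by
      rw [Real.mul_rpow (by norm_num) hx0.le]
      have h2 : (2 : ℝ) ^ δ ≤ 2 := by
        calc (2 : ℝ) ^ δ ≤ (2 : ℝ) ^ (1 : ℝ) := Real.rpow_le_rpow_of_exponent_le (by norm_num) hδ1
          _ = 2 := Real.rpow_one 2
      exact mul_le_mul_of_nonneg_right h2 hxδ0
    have hxδz : x ^ δ ≤ x ^ (δ + e) := Real.rpow_le_rpow_of_exponent_le hx1 (by linarith)
    have hyz : x ^ e ≤ x ^ (δ + e) := Real.rpow_le_rpow_of_exponent_le hx1 (by linarith)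
    have hz : x ^ δ * x ^ e = x ^ (δ + e) := (Real.rpow_add hx0 δ e).symm
    have hz0 : 0 < x ^ (δ + e) := Real.rpow_pos_of_pos hx0 _
    have hx23 : c * x ^ ((2 : ℝ) / 3) = c * x ^ e * x ^ (δ + e) := by
      rw [← hsum, Real.rpow_add hx0 (δ + e) e]; ring
    have i1 : Real.log ((12 * x + 1) * M) * (2 * x) ^ δ ≤ (Real.log (13 * M) + Real.log x) * (2 * x ^ δ) :=
      mul_le_mul hlb hE hE0 (by linarith)
    have i2 : Real.log x * x ^ δ ≤ e⁻¹ * x ^ (δ + e) := by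
      calc Real.log x * x ^ δ ≤ (e⁻¹ * x ^ e) * x ^ δ := mul_le_mul_of_nonneg_right ht hxδ0
        _ = e⁻¹ * (x ^ δ * x ^ e) := by ring
        _ = e⁻¹ * x ^ (δ + e) := by rw [hz]
    have i3 : Real.log (13 * M) * x ^ δ ≤ Real.log (13 * M) * x ^ (δ + e) :=
      mul_le_mul_of_nonneg_left hxδz hL0
    have i4 : K * Real.log x ≤ |K| * e⁻¹ * x ^ (δ + e) := by
      calc K * Real.log x ≤ |K| * Real.log x := mul_le_mul_of_nonneg_right (le_abs_self K) ht0
        _ ≤ |K| * (e⁻¹ * x ^ e) := mul_le_mul_of_nonneg_left ht (abs_nonneg K)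
        _ ≤ |K| * (e⁻¹ * x ^ (δ + e)) :=
          mul_le_mul_of_nonneg_left (mul_le_mul_of_nonneg_left hyz hie0.le) (abs_nonneg K)
        _ = |K| * e⁻¹ * x ^ (δ + e) := by ring
    have i5 : (2 * Real.log (13 * M) + 2 * e⁻¹ + |K| * e⁻¹) * x ^ (δ + e) < c * x ^ e * x ^ (δ + e) :=
      mul_lt_mul_of_pos_right hB hz0
    have main : Real.log ((12 * x + 1) * M) * (2 * x) ^ δ + -(c * x ^ ((2 : ℝ) / 3)) < Real.log x * -K := by
      rw [hx23]; linarith [i1, i2, i3, i4, i5]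
    have hA : ((12 * x + 1) * M) ^ ((2 * x) ^ δ) = Real.exp (Real.log ((12 * x + 1) * M) * (2 * x) ^ δ) :=
      Real.rpow_def_of_pos hb0 _
    have hR : x ^ (-K) = Real.exp (Real.log x * -K) := Real.rpow_def_of_pos hx0 _
    rw [hA, hR, ← Real.exp_add, Real.exp_lt_exp]
    exact main
  -- (2) suppose θ(p_c) > 0 and derive a contradiction
  refine (Literature.Probability.Percolation.percolationContinuityZ3_iff).mpr ?_
  by_contra hne
  have hθ : 0 < Literature.Probability.Percolation.theta (Literature.Probability.LatticeModels.zdGraph 3)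
      (0 : Literature.Probability.LatticeModels.Site 3) (Literature.Probability.Percolation.criticalProbI 3) :=
    lt_of_le_of_ne MeasureTheory.measureReal_nonneg (Ne.symm hne)
  have hp0 : 0 < ((Literature.Probability.Percolation.criticalProbI 3 : unitInterval) : ℝ) := by
    rw [Literature.Probability.Percolation.coe_criticalProbI]
    exact Literature.Probability.Percolation.criticalProb_zd_pos 3 (by norm_num)
  have hp1 : ((Literature.Probability.Percolation.criticalProbI 3 : unitInterval) : ℝ) < 1 := by
    rw [Literature.Probability.Percolation.coe_criticalProbI]
    exact Literature.Probability.Percolation.criticalProb_zd_lt_one (by norm_num)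
  obtain ⟨δ, K, hδ0, hδ23, hfreq⟩ := hP hθ hQ
  obtain ⟨c, hc, hKb⟩ := hK (Literature.Probability.Percolation.criticalProbI 3) hθ
  obtain ⟨e, he⟩ : ∃ e : ℝ, e = (2 / 3 - δ) / 2 := ⟨_, rfl⟩
  have he0 : 0 < e := by rw [he]; linarith
  have hsum : δ + e + e = 2 / 3 := by rw [he]; ring
  -- the entropy constant is eventually beaten by c · s^e (s → ∞ along ℕ)
  have hB : ∀ᶠ s : ℕ in Filter.atTop,
      2 * Real.log (13 * max 1 (((Literature.Probability.Percolation.criticalProbI 3 : unitInterval) : ℝ) /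
        (1 - ((Literature.Probability.Percolation.criticalProbI 3 : unitInterval) : ℝ)))) + 2 * e⁻¹ + |K| * e⁻¹ <
        c * (s : ℝ) ^ e :=
    tendsto_natCast_atTop_atTop.eventually
      (((tendsto_rpow_atTop he0).const_mul_atTop hc).eventually_gt_atTop _)
  obtain ⟨s, hs, hsB, hs1⟩ := (hfreq.and_eventually (hB.and (Filter.eventually_ge_atTop 1))).exists
  have hx1 : (1 : ℝ) ≤ (s : ℝ) := by exact_mod_cast hs1
  have hGs := hG (Literature.Probability.Percolation.criticalProbI 3) hp0 hp1 δ hδ0.le s hs1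
  have hKs := hKb s hs1
  have hM1 : (1 : ℝ) ≤ max 1 (((Literature.Probability.Percolation.criticalProbI 3 : unitInterval) : ℝ) /
      (1 - ((Literature.Probability.Percolation.criticalProbI 3 : unitInterval) : ℝ))) := le_max_left _ _
  have hlt := key δ K c _ e (s : ℝ) hδ0 he0 hsum hc hM1 hx1 hsB
  have hA0 : (0 : ℝ) ≤ ((12 * (s : ℝ) + 1) * max 1
      (((Literature.Probability.Percolation.criticalProbI 3 : unitInterval) : ℝ) /
        (1 - ((Literature.Probability.Percolation.criticalProbI 3 : unitInterval) : ℝ)))) ^ ((2 * (s : ℝ)) ^ δ) :=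
    Real.rpow_nonneg (mul_nonneg (by positivity) (le_trans zero_le_one hM1)) _
  exact absurd (lt_of_le_of_lt (hs.trans (hGs.trans (mul_le_mul_of_nonneg_left hKs hA0))) hlt) (lt_irrefl _)

end Summit.CriticalPhenomena.PercolationContinuityZ3.Theses.PercPorousCritical
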